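import Summits.QuantumFields.BalabanUV.Beta.StepDefectTadpole

/-!
# `BalabanUV.Beta.PolarizationComposite` — binder row D1, route (O3): **THE ONE-LOOP POLARIZATION OF A COMPOSITE FAMILY IS THE
# TRANSPORTED POLARIZATION PLUS THE STEP POLARIZATION PLUS A TADPOLE TERM** — K-U2 (`StepDefectTadpole`) in the coordinates of
# pv09∕an2's `OneLoop.hessianAt` ∕ `OneLoop.polarization` (the typed model of [Balaban1987RG1] (1.20))
# (β sub-cell, BINDER-OWNERS row D1 OWNER, lineage an2 gen 23; sequel of K-U2 p237053)

HONEST FRAMING (cell charter, verbatim): «discharging BetaPertH makes Balaban's UV stability UNCONDITIONAL — a real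
constructive-QFT result; it is NOT the continuum limit and NOT the Clay problem.»
HONEST DEPENDENCY: continuum YM on T⁴ ⇐ BetaPertH ∧ nine spine estimates (0/9 proved); BetaPertH ⇐ (D1) ∧ (D4) ∧ CAP+tail;
G-an2-4 gates asym, D1 and NE2/3/4.
ABSOLUTE RULE (cell, verbatim): «No internally-minted statement may enter as a cited fact. Every hypothesis is either kernel-proved in this
package or a verbatim quotation of a PUBLISHED theorem with page reference. The manuscript(s) under audit are NOT citable for their own
disputed steps — they are the thing under adjudication; programme-internal (2001/route/tribunal) claims are never citable.»
NOTHING below is cited: no `[cite: …]`, no `def`, no `Prop` fact.  Every declaration is [folklore] finite-dimensional calculus (Mathlib `fderiv`,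
`iteratedFDeriv_two_apply`, `Finset` sums) over K-U2's `StepDefectTadpole.fderiv_fderiv_comp` ∕ `stepDefect_eq_firstJet_secondResponse` and the
tree's `OneLoop.hessianAt` ∕ `OneLoop.polarization` ∕ `Family.logZ` ∕ `FamilyRegularity`'s `Family.contDiffAt_logZ` BY NAME.  It asserts nothing about
Bałaban's objects: the FUBINI hypothesis (one-shot functional at the next level = one-shot functional at this level ∘ step minimiser + step functional
+ const, as functions near the trivial background) and the families themselves are HYPOTHESES ∕ parameters.

WHY (row-D1 owner, gen 23; FINDING X-an2-54 and ROUTE (O3), `BETA/AN2.md` §51.4).  The telescoping clause (T′) of row D1 says, level by level, «one-shot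
kernel at blocking `Lc^{m+1}` = one-shot kernel at `Lc^m` transported on both legs by the last step's response + the last step's kernel» up to a defect
whose `(μ,ν)` second moment must vanish.  On a finite volume every kernel in that sentence is a `hessianAt` of a one-loop functional (`polarization` =
`hessianAt ∘ Family.logZ`), Gaussian Fubini with the Faddeev–Popov quotients makes the functionals ADD along the step minimiser map (an5's
`SliceComposition` §7 at fixed matrices), and THIS FILE records what the second jets then do, IN COORDINATES: `hessianAt Φ i j = Σ_{a,b} J_{ia} J_{jb} ·
hessianAt f a b + hessianAt φ i j + Σ_a H_{a,ij} · ∂_a f(0)` with the JACOBIAN `J_{ia} = ∂_i U_a(0)` of the step minimiser (the two-leg transport of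
`StepRecursion`) and its SECOND RESPONSE `H_{a,ij} = ∂_i∂_j U_a(0)` — so the step defect is the TADPOLE vector `(∂_a f(0))_a` contracted with the second
response, and VANISHES for a tadpole-free one-shot functional (global colour invariance in the genuine theory; a table property in the colour-stripped
literal).  For `Family` polarizations this is «polarization of the composite = transported polarization + step polarization (+ tadpole·U″)», the finite-volume
shape of exact (SDF).

WHAT (all [folklore]; `ι`, `κ` finite coordinate types — coarse and fine background bonds):
§1 COORDINATES: `clm_apply_eq_sum_single` (`ℓ v = Σ_a v a • ℓ e_a`), `clm₂_apply_eq_sum_single` (`L v w = Σ_a Σ_b (v a * w b) • L e_a e_b`).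
§2 FUNCTIONS: **`hessianAt_comp_eq`** (the displayed coordinate formula under the Fubini hypothesis `Φ =ᶠ[𝓝 0] f ∘ U + φ + c`, `U 0 = 0`, `U`, `φ` C² at `0`,
   `f` C² at `0`), **`hessianAt_comp_eq_of_tadpoleFree`** (`fderiv ℝ f 0 = 0` ⟹ no tadpole term).
§3 FAMILIES: **`polarization_comp_eq`** ∕ **`polarization_comp_eq_of_tadpoleFree`** — the same with `Φ := F₂.logZ`, `f := F₁.logZ`, `φ := Fs.logZ`
   (`F₂ Fs : Family ι …` the one shot at the next level and the step, `F₁ : Family κ …` the one shot at this level), smoothness discharged from `C²` entries and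
   nonsingular bordered matrices by `Family.contDiffAt_logZ`.
Provenance: β sub-cell, unit beta-an2 gen 23 (prover-b2b-balaban-beta-an2-g23-0), 2026-08-20.  NOT (SDF), NOT D1, NOT `BetaPertH`, NOT continuum, NOT Clay.
-/

open Filter Topology Finset
open scoped BigOperators
open Literature.MathematicalPhysics.QuantumFieldTheory.Balaban1983to89.Beta (hessianAt polarization Family)
open Summit.QuantumFields.BalabanUV.Beta.StepDefectTadpole (fderiv_fderiv_comp stepDefect_eq_firstJet_secondResponse)

namespace Summit.QuantumFields.BalabanUV.Beta.PolarizationComposite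

variable {ι κ : Type*} [Fintype ι] [DecidableEq ι] [Fintype κ] [DecidableEq κ]
variable {G : Type*} [NormedAddCommGroup G] [NormedSpace ℝ G]

/-! ## §1 Coordinates: evaluating (bi)linear maps on `κ → ℝ` through the basis `Pi.single a 1` -/

omit [DecidableEq ι] [Fintype ι] in
/-- [folklore] `ℓ v = Σ_a v a • ℓ e_a` for a continuous linear map on `κ → ℝ`. -/
theorem clm_apply_eq_sum_single (ℓ : (κ → ℝ) →L[ℝ] G) (v : κ → ℝ) :
    ℓ v = ∑ a, v a • ℓ (Pi.single a 1) := by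
  conv_lhs => rw [← Finset.univ_sum_single v]
  rw [map_sum]
  refine Finset.sum_congr rfl fun a _ => ?_
  rw [← map_smul]
  congr 1
  ext b
  simp [Pi.single_apply]

omit [DecidableEq ι] [Fintype ι] in
/-- [folklore] `L v w = Σ_a Σ_b (v a * w b) • L e_a e_b` for a continuous bilinear map on `κ → ℝ`. -/
theorem clm₂_apply_eq_sum_single (L : (κ → ℝ) →L[ℝ] (κ → ℝ) →L[ℝ] G) (v w : κ → ℝ) :
    L v w = ∑ a, ∑ b, (v a * w b) • L (Pi.single a 1) (Pi.single b 1) := by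
  rw [clm_apply_eq_sum_single L v, _root_.sum_apply]
  refine Finset.sum_congr rfl fun a _ => ?_
  rw [_root_.smul_apply, clm_apply_eq_sum_single (L (Pi.single a 1)) w, Finset.smul_sum]
  refine Finset.sum_congr rfl fun b _ => ?_
  rw [smul_smul]

/-! ## §2 The Hessian at `0` of `f ∘ U + φ + c`, in coordinates -/

/-- [folklore] **THE HESSIAN OF A COMPOSITE, IN COORDINATES.**  Under the FUBINI hypothesis `Φ =ᶠ[𝓝 0] fun x ↦ f (U x) + φ x + c` with `U 0 = 0`, `U` and
`φ` of class `C²` at `0` and `f` of class `C²` at `0`: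
`hessianAt Φ i j = Σ_a Σ_b (∂_i U_a · ∂_j U_b) · hessianAt f a b + hessianAt φ i j + Σ_a (∂_i∂_j U_a) · ∂_a f(0)`
(`∂_i U_a := fderiv ℝ U 0 eᵢ a`, `∂_i∂_j U_a := fderiv ℝ (fderiv ℝ U) 0 eᵢ eⱼ a`, `∂_a f(0) := fderiv ℝ f 0 e_a`) — transported Hessian + step Hessian + TADPOLE
vector contracted with the SECOND RESPONSE. -/
theorem hessianAt_comp_eq {Φ φ : (ι → ℝ) → ℝ} {U : (ι → ℝ) → (κ → ℝ)} {f : (κ → ℝ) → ℝ} {c : ℝ}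
    (hΦ : Φ =ᶠ[𝓝 0] fun x => f (U x) + φ x + c) (hU0 : U 0 = 0) (hU : ContDiffAt ℝ 2 U 0) (hf : ContDiffAt ℝ 2 f 0)
    (hφ : ContDiffAt ℝ 2 φ 0) (i j : ι) :
    hessianAt Φ i j =
      (∑ a, ∑ b, (fderiv ℝ U 0 (Pi.single i 1) a * fderiv ℝ U 0 (Pi.single j 1) b) * hessianAt f a b)
        + hessianAt φ i j
        + ∑ a, fderiv ℝ (fderiv ℝ U) 0 (Pi.single i 1) (Pi.single j 1) a * fderiv ℝ f 0 (Pi.single a 1) := by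
  have hf' : ContDiffAt ℝ 2 f (U 0) := by rw [hU0]; exact hf
  have h := stepDefect_eq_firstJet_secondResponse hΦ hU hf' hφ (Pi.single i 1) (Pi.single j 1)
  rw [hU0] at h
  simp only [hessianAt, iteratedFDeriv_two_apply, Matrix.cons_val_zero, Matrix.cons_val_one]
  rw [sub_sub, sub_eq_iff_eq_add] at h
  rw [h, clm₂_apply_eq_sum_single (fderiv ℝ (fderiv ℝ f) 0), clm_apply_eq_sum_single (fderiv ℝ f 0)]
  simp only [smul_eq_mul]
  ring

/-- [folklore] **TADPOLE-FREE ⟹ EXACT TELESCOPING OF HESSIANS**: if moreover `fderiv ℝ f 0 = 0`,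
`hessianAt Φ i j = Σ_a Σ_b (∂_i U_a · ∂_j U_b) · hessianAt f a b + hessianAt φ i j`. -/
theorem hessianAt_comp_eq_of_tadpoleFree {Φ φ : (ι → ℝ) → ℝ} {U : (ι → ℝ) → (κ → ℝ)} {f : (κ → ℝ) → ℝ} {c : ℝ}
    (hΦ : Φ =ᶠ[𝓝 0] fun x => f (U x) + φ x + c) (hU0 : U 0 = 0) (hU : ContDiffAt ℝ 2 U 0) (hf : ContDiffAt ℝ 2 f 0)
    (hφ : ContDiffAt ℝ 2 φ 0) (htad : fderiv ℝ f 0 = 0) (i j : ι) :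
    hessianAt Φ i j =
      (∑ a, ∑ b, (fderiv ℝ U 0 (Pi.single i 1) a * fderiv ℝ U 0 (Pi.single j 1) b) * hessianAt f a b)
        + hessianAt φ i j := by
  rw [hessianAt_comp_eq hΦ hU0 hU hf hφ, htad]
  simp

/-! ## §3 Families: the one-loop polarization of a composite -/

section Families

variable {n₁ m₁ n₂ m₂ ns ms : ℕ}

/-- [folklore] **POLARIZATION OF A COMPOSITE FAMILY** (route (O3) shape, finite volume).  Let `F₂ : Family ι n₂ m₂` (the ONE SHOT at the next level),
`F₁ : Family κ n₁ m₁` (the one shot at this level), `Fs : Family ι ns ms` (the STEP), and let `U` (the step minimiser map on backgrounds, `U 0 = 0`, C² at `0`)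
satisfy the FUBINI hypothesis `F₂.logZ =ᶠ[𝓝 0] fun x ↦ F₁.logZ (U x) + Fs.logZ x + c`; entries `C²` at the base points and bordered matrices nonsingular
there.  Then
`polarization F₂ i j = Σ_a Σ_b (∂_i U_a · ∂_j U_b) · polarization F₁ a b + polarization Fs i j + Σ_a (∂_i∂_j U_a) · ∂_a(F₁.logZ)(0)`. -/
theorem polarization_comp_eq (F₂ : Family ι n₂ m₂) (F₁ : Family κ n₁ m₁) (Fs : Family ι ns ms)
    {U : (ι → ℝ) → (κ → ℝ)} {c : ℝ}
    (hfub : F₂.logZ =ᶠ[𝓝 0] fun x => F₁.logZ (U x) + Fs.logZ x + c) (hU0 : U 0 = 0) (hU : ContDiffAt ℝ 2 U 0)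
    (hQ₁ : ∀ a b, ContDiffAt ℝ 2 (fun B => (F₁ B).Q a b) 0) (hΔ₁ : ∀ a b, ContDiffAt ℝ 2 (fun B => (F₁ B).Δ a b) 0)
    (hdet₁ : (F₁ 0).kkt.det ≠ 0)
    (hQs : ∀ a b, ContDiffAt ℝ 2 (fun B => (Fs B).Q a b) 0) (hΔs : ∀ a b, ContDiffAt ℝ 2 (fun B => (Fs B).Δ a b) 0)
    (hdets : (Fs 0).kkt.det ≠ 0) (i j : ι) :
    polarization F₂ i j =
      (∑ a, ∑ b, (fderiv ℝ U 0 (Pi.single i 1) a * fderiv ℝ U 0 (Pi.single j 1) b) * polarization F₁ a b)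
        + polarization Fs i j
        + ∑ a, fderiv ℝ (fderiv ℝ U) 0 (Pi.single i 1) (Pi.single j 1) a * fderiv ℝ F₁.logZ 0 (Pi.single a 1) := by
  have h1 : ContDiffAt ℝ 2 F₁.logZ 0 := F₁.contDiffAt_logZ hQ₁ hΔ₁ hdet₁
  have hs : ContDiffAt ℝ 2 Fs.logZ 0 := Fs.contDiffAt_logZ hQs hΔs hdets
  simp only [Literature.MathematicalPhysics.QuantumFieldTheory.Balaban1983to89.Beta.polarization_eq_hessianAt]
  exact hessianAt_comp_eq hfub hU0 hU h1 hs i j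

/-- [folklore] **TADPOLE-FREE COMPOSITE: THE POLARIZATIONS TELESCOPE EXACTLY** — if moreover `fderiv ℝ F₁.logZ 0 = 0` (the one-shot functional at this
level has no one-point function at the trivial background), then
`polarization F₂ i j = Σ_a Σ_b (∂_i U_a · ∂_j U_b) · polarization F₁ a b + polarization Fs i j` — the finite-volume shape of exact (SDF). -/
theorem polarization_comp_eq_of_tadpoleFree (F₂ : Family ι n₂ m₂) (F₁ : Family κ n₁ m₁) (Fs : Family ι ns ms)
    {U : (ι → ℝ) → (κ → ℝ)} {c : ℝ}
    (hfub : F₂.logZ =ᶠ[𝓝 0] fun x => F₁.logZ (U x) + Fs.logZ x + c) (hU0 : U 0 = 0) (hU : ContDiffAt ℝ 2 U 0)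
    (hQ₁ : ∀ a b, ContDiffAt ℝ 2 (fun B => (F₁ B).Q a b) 0) (hΔ₁ : ∀ a b, ContDiffAt ℝ 2 (fun B => (F₁ B).Δ a b) 0)
    (hdet₁ : (F₁ 0).kkt.det ≠ 0)
    (hQs : ∀ a b, ContDiffAt ℝ 2 (fun B => (Fs B).Q a b) 0) (hΔs : ∀ a b, ContDiffAt ℝ 2 (fun B => (Fs B).Δ a b) 0)
    (hdets : (Fs 0).kkt.det ≠ 0) (htad : fderiv ℝ F₁.logZ 0 = 0) (i j : ι) :
    polarization F₂ i j =
      (∑ a, ∑ b, (fderiv ℝ U 0 (Pi.single i 1) a * fderiv ℝ U 0 (Pi.single j 1) b) * polarization F₁ a b)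
        + polarization Fs i j := by
  rw [polarization_comp_eq F₂ F₁ Fs hfub hU0 hU hQ₁ hΔ₁ hdet₁ hQs hΔs hdets, htad]
  simp

end Families

end Summit.QuantumFields.BalabanUV.Beta.PolarizationComposite
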